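import Summits.BirchSwinnertonDyer.Rank1Residual.X11b.KolyvaginShaOrderOfPoints
import Summits.BirchSwinnertonDyer.Rank1Residual.X11b.KolyvaginHpointsAssemblyAt
import Summits.BirchSwinnertonDyer.Rank1Residual.X11b.KolyvaginReciprocityFinsetOfPoitouTate
import Summits.BirchSwinnertonDyer.Rank1Residual.X11b.KolyvaginHGZOfKodairaNeron
import HarnessLib

/-!
# Kolyvagin's bound on `Ш(E/K)[p^∞]` (order form) at ONE odd surjective prime, from the cite-only
# leaf inputs AT that prime and the Cassels–Tate inputs (cell `b2b-bsdres`, team x11b3 = N8/O2;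
# x11b3-p2 GEN 41, (P2-ORDER-UB) (O-d″) part 3)

HONEST FRAMING (cell `b2b-bsdres`, run/shared/lean/b2b/bsd-rank1-residual/, verbatim in every
file): the goal of the cell is to DELETE the COMBINATION-SHAPED residual classes of the
Birch–Swinnerton-Dyer formula for ALL analytic-rank `≤ 1` elliptic curves over `ℚ` — "full BSD
formula for every rank `≤ 1` curve in class `C`" assembled STRICTLY from published theorems — so
that the rank-`≤ 1` remainder becomes exactly the CONSTRUCTION-SHAPED classes, which are TYPED
(missing-input `Prop`s), NOT attempted. This is not "finishing BSD". Team N8/O2 = `x11b3`.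
THEOREMS ONLY (no `def`, no `sorry`, no new fact); plumbing over tree theorems; cite-only labels are
NOT facts; nothing discharged; nothing booked; no mark / label / count / tier moves.

## What this file adds

The ORDER-form companion of `X11b/KolyvaginShaAnnihilatorAtPrime` (Kolyvagin's annihilator from SIX
labels): from the SAME SIX cite-only labels AT `p` {`hPT`, `hrec`, `hCM`, `h53`, `hGZ`, `hγ`} + `hN`,
McCallum 1991 §1 Theorem (Kolyvagin) in ORDER form at one prime — `Ш(E/K)[p^∞]` finite,
`p^{M₀} Ш(E/K)[p^∞] = 0`, `#Ш(E/K)[p^∞] ≤ p^{2M₀}`, `ord_p #Ш(E/K)[p^∞] ≤ 2M₀` for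
`p^{M₀} x₀ = y_K ∉ p^{M₀+1}E(K)` (`M₀ = ord_p [E(K) : ℤ y_K]` ≥ 1, McCallum Lemma 5.1) — GRANTED, in
addition, the displayed Cassels–Tate inputs at level `p^{M₀}` (the tree's own open inputs of
`exists_casselsTate_pairing_of_inputs`: the Weil pairing `e` alternating and non-degenerate, local
invariants `inv` with `hPT'` = `SumInvLocalizationEqZero` and `hinv` = injective at finite places,
`hH3`, `hB` = Milne I 6.13(a) `IsLevelPairing`, `hPτ` = `Gal(K/ℚ)`-equivariance on Selmer classes).
Composition of `KolyvaginOrder.card_sha_primary_le_at_of_pointsM_of_reciprocityFinset_of_localDuality`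
(this lineage; behind it: Kolyvagin's Cassels–Tate argument McCallum Thm. 5.4 / Cor. 5.6 re-run
over `HypothesesM`, Milne's level-`p^{M₀}` pairing pulled back to `Sel_{p^{2M₀}}`, McCallum's Lemma
5.3 for the Cassels–Tate local term, Kolyvagin's annihilation by Prop. 2.2 at two places) with
`KolyvaginAssembly.hpoints_at_of_perLevelChoice` (p321380) and
`KolyvaginReciprocity.kolyvaginReciprocityFinset_of_poitouTate` (this lineage, from `hPT`).
Binders = those of `KolyvaginAnnihilator.pow_smul_sha_primary_eq_zero_at_of_leafInputs_of_poitouTate`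
VERBATIM; the conclusion's prefix gains `M₀ ≥ 1`, the complex conjugation `c`, `x₀`, and the
Cassels–Tate inputs.  This is the tree's named fact `Kolyvagin1990_padicValNat_card_sha_le` at ONE
prime for the `p`-primary part, modulo the displayed inputs — NOT that fact (which is unconditional
in the Cassels–Tate inputs and states `ord_p #Ш(E/K)`); nothing discharged; nothing booked.

* `card_sha_primary_le_at_of_leafInputs_of_poitouTate_of_localDuality` — SIX labels AT `p` + `hN`;
* `card_sha_primary_le_at_of_leafInputs_of_poitouTate_of_kodairaNeron_of_localDuality` — FIVE labels
  on the Kodaira–Néron sub-class (KN_p) (`hGZ` supplied by `KolyvaginHloc.hGZ_of_kodairaNeron`).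

Namespace `Summit.BirchSwinnertonDyer.Rank1Residual.X11b.KolyvaginOrder`; `K : Type`; axioms
`propext`, `Classical.choice`, `Quot.sound`.

## References

* [McCallumLMS1991] §1 Theorem (Kolyvagin) p. 296, Lemma 5.1 p. 303, §2 Prop. 2.2, §4 Prop. 4.7,
  §5 Lemma 5.3, Thm. 5.4, Cor. 5.6 (held, PDF pp. 276–287). [GrossLMS1991] Thm. 1.3 (2), Thm. 2.2
  (2), §§3–8, §10 (held, chunks 212–231). [MilneADT2006] Ch. I §6 Prop. 6.9, Thm. 6.13(a); Thm.
  4.10(b). [SilvermanAEC2009] Thm. VII.6.1.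
-/

noncomputable section

namespace Summit.BirchSwinnertonDyer.Rank1Residual.X11b.KolyvaginOrder

open scoped Classical
open WeierstrassCurve Field NumberField IsDedekindDomain Function
open Literature.NumberTheory.EllipticCurves Literature.NumberTheory.GaloisRepresentations
open Literature.NumberTheory.EllipticCurves.RingClassField
open Literature.NumberTheory.EllipticCurves.ModularForms
open Literature.NumberTheory.DiophantineGeometry Literature.NumberTheory.DiophantineGeometry.TateAlgorithm
open Literature.NumberTheory.GaloisCohomology
open Literature.NumberTheory.GaloisRepresentations.DiscreteGaloisModule (mu MuCarrier)
open KolyvaginAssembly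

-- Cup products need `LocallyCompactSpace Γ_K`; as in the tree's Cassels–Tate files.
attribute [local instance] absoluteGaloisGroup_compactSpace

-- `CharZero` of the completions (the Cassels–Tate local terms), as in the tree's files.
attribute [local instance] charZero_placeCompletion

-- `K : Type`: the tree's ring-class class field theory is universe `0`.
variable {K : Type} [Field K] [NumberField K] {N : ℕ} {W : WeierstrassCurve ℚ}

/-- **Kolyvagin's bound on `Ш(E/K)[p^∞]` (order form) at ONE odd prime `p` with `ρ̄_{E,p}` onto,
from the cite-only printed inputs AT `p` with Kolyvagin reciprocity SUPPLIED modulo the Poitou–Tate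
named fact, GRANTED the displayed Cassels–Tate inputs at level `p^{M₀}`** (McCallum 1991 §1 Theorem
(Kolyvagin) / Cor. 5.6 at one prime; module docstring).  Binders = those of
`KolyvaginAnnihilator.pow_smul_sha_primary_eq_zero_at_of_leafInputs_of_poitouTate` VERBATIM; for
`p^{M₀} x₀ = y_K ∉ p^{M₀+1} E(K)`, `M₀ ≥ 1`: `Ш(E/K)[p^∞]` finite, killed by `p^{M₀}`, of order
`≤ p^{2M₀}`, `ord_p #Ш(E/K)[p^∞] ≤ 2M₀` ⟸ EXACTLY {`hPT`, `hrec`, `hCM`, `h53`, `hGZ`, `hγ`} AT `p`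
+ `hN` + the Cassels–Tate inputs; cite-only, NOT discharged; nothing booked; no mark.
[cite: McCallumLMS1991, §1 Theorem (Kolyvagin), Lemma 5.1, §5 Thm. 5.4, Cor. 5.6]
[cite: GrossLMS1991, Thm. 1.3 (2), Thm. 2.2 (2), §§3–8, §10]
[cite: MilneADT2006, Ch. I §6, Prop. 6.9, Thm. 6.13(a)] -/
theorem card_sha_primary_le_at_of_leafInputs_of_poitouTate_of_localDuality [NeZero N]
    [W.IsGloballyMinimal]
    {p : ℕ} (hp : p.Prime) (hp2 : p ≠ 2)
    (hPT : Literature.NumberTheory.GaloisCohomology.poitouTate_sum_localTatePairing_eq_zero K)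
    (hN : ∀ [W.IsElliptic], N = W.conductorNorm ℤ)
    (hrec : heegnerPointOfConductor_one_galoisConj N W K)
    (hCM : ∀ [W.IsElliptic] (_hK : IsImaginaryQuadratic K) (_hH : SatisfiesHeegnerHypothesis N K)
      (Dt : ModularParametrizationData W N) (β : ℤ) (ι : K →+* ℂ),
      (4 * N : ℤ) ∣ β ^ 2 - NumberField.discr K →
      ∀ {M : ℕ}, 1 ≤ M → ∀ (m : ℕ), Squarefree m →
      (∀ q ∈ m.primeFactors, IsKolyvaginPrime N W K p q ∧ FrobEqFrobInfty W K (p ^ M) q) →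
      ∃ y : (W.baseChange (ringClassField K ι m)).toAffine.Point,
        WeierstrassCurve.Affine.Point.map (W' := W) (ringClassField K ι m).subtype.toRatAlgHom y =
          heegnerPointComplexOfConductor Dt (NumberField.discr K) β m)
    (h53 : ∀ [W.IsElliptic] (_hK : IsImaginaryQuadratic K) (_hH : SatisfiesHeegnerHypothesis N K)
      (Dt : ModularParametrizationData W N) (β : ℤ) (ι : K →+* ℂ) {M : ℕ}
      (_hM : 1 ≤ M) {n : ℕ} (_hn : Squarefree n)
      (_hKol : ∀ q ∈ n.primeFactors, IsKolyvaginPrime N W K p q ∧ FrobEqFrobInfty W K (p ^ M) q)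
      (d : (m : ℕ) → m ∣ n → KolyvaginHeegnerData Dt β ι m) (m : ℕ) (hm : m ∣ n)
      (τm : ringClassField K ι m ≃ₐ[ℚ] ringClassField K ι m),
      (∀ x : ringClassField K ι m, ((τm x : ringClassField K ι m) : ℂ) = starRingEnd ℂ x) →
      ∃ σ' ∈ ringClassGal ι m, IsOfFinAddOrder
        (pointGalHom W (ringClassField K ι m) τm (d m hm).y -
          (-W.rootNumber) • pointGalHom W (ringClassField K ι m) σ' (d m hm).y))
    (hGZ : ∀ [W.IsElliptic] (_hK : IsImaginaryQuadratic K) (_hH : SatisfiesHeegnerHypothesis N K)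
      (Dt : ModularParametrizationData W N) (β : ℤ) (ι : K →+* ℂ) {M : ℕ} (_hM : 1 ≤ M) {n : ℕ}
      (_hn : Squarefree n)
      (_hKol : ∀ q ∈ n.primeFactors, IsKolyvaginPrime N W K p q ∧ FrobEqFrobInfty W K (p ^ M) q)
      (d : (m : ℕ) → m ∣ n → KolyvaginHeegnerData Dt β ι m),
      ∃ n' : ℤ, IsCoprime ((p ^ M : ℕ) : ℤ) n' ∧
        ∀ (m : ℕ) (hm : m ∣ n) (γ : ringClassField K ι m ≃ₐ[ℚ] ringClassField K ι m),
          γ ∈ ringClassGal ι m → ∀ v : HeightOneSpectrum (𝓞 K),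
            ¬ (W.baseChange K).HasGoodReductionAt v →
            n' • pointsMap (W.baseChange K) (v.adicCompletion K)
                ((d m hm).toGeomPoints (pointGalHom W (ringClassField K ι m) γ (d m hm).y)) ∈
              E0Receptacle (W.baseChange K) v ∧
            ∀ (ℓ : ℕ) (hℓ : ℓ ∈ m.primeFactors)
              (hle : ringClassField K ι (m / ℓ) ≤ ringClassField K ι m),
              n' • pointsMap (W.baseChange K) (v.adicCompletion K)
                  ((d m hm).toGeomPoints (pointGalHom W (ringClassField K ι m) γ
                    (WeierstrassCurve.Affine.Point.map (W' := W)
                      ((RingClassField.inclusion ι hle).restrictScalars ℚ)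
                      (d (m / ℓ)
                        ((Nat.div_dvd_of_dvd (Nat.dvd_of_mem_primeFactors hℓ)).trans hm)).y))) ∈
                E0Receptacle (W.baseChange K) v)
    (hγ : ∀ [W.IsElliptic] (_hK : IsImaginaryQuadratic K) (_hH : SatisfiesHeegnerHypothesis N K)
      (Dt : ModularParametrizationData W N) (β : ℤ) (ι : K →+* ℂ) {M : ℕ}
      (_hM : 1 ≤ M) {n : ℕ} (_hn : Squarefree n)
      (_hKol : ∀ q ∈ n.primeFactors, IsKolyvaginPrime N W K p q ∧ FrobEqFrobInfty W K (p ^ M) q)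
      (d : (m : ℕ) → m ∣ n → KolyvaginHeegnerData Dt β ι m)
      (m : ℕ) (hm : m ∣ n) (ℓ : ℕ) (hℓ : ℓ ∈ m.primeFactors) [Fact ℓ.Prime]
      (hΔ : ¬ (ℓ : ℤ) ∣ minimalDiscriminantInt W) (φ₀ : absoluteGaloisGroup (ZMod ℓ)),
      (∀ x : AlgebraicClosure (ZMod ℓ), φ₀ • x = x ^ ℓ) →
      ∀ (hle : ringClassField K ι (m / ℓ) ≤ ringClassField K ι m)
        (γ : ringClassField K ι m ≃ₐ[ℚ] ringClassField K ι m), γ ∈ ringClassGal ι m →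
        geomReduction hΔ ((RatClosure.pointsEquiv (K := K) W).symm
            ((d m hm).toGeomPoints (pointGalHom W (ringClassField K ι m) γ (d m hm).y))) =
          φ₀ • geomReduction hΔ ((RatClosure.pointsEquiv (K := K) W).symm
            ((d m hm).toGeomPoints (pointGalHom W (ringClassField K ι m) γ
              (WeierstrassCurve.Affine.Point.map (W' := W)
                ((RingClassField.inclusion ι hle).restrictScalars ℚ)
                (d (m / ℓ)
                  ((Nat.div_dvd_of_dvd (Nat.dvd_of_mem_primeFactors hℓ)).trans hm)).y))))) :
    ∀ [W.IsElliptic] (_hE : ¬ W.HasCM) (_hK : IsImaginaryQuadratic K)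
      (_hD : NumberField.discr K ≠ -3 ∧ NumberField.discr K ≠ -4)
      (_hH : SatisfiesHeegnerHypothesis N K)
      {P : (W.baseChange K).toAffine.Point} (_hP : IsHeegnerPoint N W K P)
      (_hnt : ¬ IsOfFinAddOrder P) (_hρ : W.HasSurjectiveModNGaloisRep p)
      {M₀ : ℕ} (_hM₀ : 1 ≤ M₀) [NeZero (p ^ M₀)] {c : K ≃ₐ[ℚ] K} (_hc : c ≠ 1) (_hcc : c * c = 1)
      {x₀ : (W.baseChange K).toAffine.Point} (_hx₀ : p ^ M₀ • x₀ = P)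
      (_hmax : ∀ Q : (W.baseChange K).toAffine.Point, p ^ (M₀ + 1) • Q ≠ P)
      (e : geomTorsion (W.baseChange K) ((p ^ M₀ * p ^ M₀ : ℕ) : ℤ) →
        geomTorsion (W.baseChange K) ((p ^ M₀ * p ^ M₀ : ℕ) : ℤ) → AlgebraicClosure K)
      (hμ : ∀ S T, e S T ^ (p ^ M₀ * p ^ M₀) = 1)
      (hadd₁ : ∀ S₁ S₂ T, e (S₁ + S₂) T = e S₁ T * e S₂ T)
      (hadd₂ : ∀ S T₁ T₂, e S (T₁ + T₂) = e S T₁ * e S T₂)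
      (hgal : ∀ (σ : absoluteGaloisGroup K) (S T : geomTorsion (W.baseChange K) ((p ^ M₀ * p ^ M₀ : ℕ) : ℤ)),
        σ • e S T = e (σ • S) (σ • T))
      (halt : ∀ T, e T T = 1) (hnondeg : ∀ T, (∀ S, e S T = 1) → T = 0)
      (inv : LocalInvariants K (p ^ M₀ * p ^ M₀)) (hPT' : inv.SumInvLocalizationEqZero)
      (hinv : ∀ v : HeightOneSpectrum (𝓞 K), Injective (inv (Sum.inr v)))
      (hH3 : ∀ x : galoisCohomology (mu K (p ^ M₀ * p ^ M₀)) 3,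
        (∀ v : Place K, galoisCohomology.localization (mu K (p ^ M₀ * p ^ M₀)) v 3 x = 0) → x = 0)
      (hB : Literature.GroupTheory.FiniteAbelian.IsLevelPairing (p ^ M₀)
        (ctLevelPairing (W.baseChange K) (p ^ M₀) e hμ hadd₁ hadd₂ hgal inv halt hPT' hH3
          (localTerm_finite_support (W := W.baseChange K) (m := p ^ M₀) (e := e) (hμ := hμ)
            (hadd₁ := hadd₁) (hadd₂ := hadd₂) (hgal := hgal) halt inv)))
      (hPτ : ∀ z ∈ selmerGroup (W.baseChange K) ((p ^ M₀ * p ^ M₀ : ℕ) : ℤ),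
        ∀ t ∈ selmerGroup (W.baseChange K) ((p ^ M₀ * p ^ M₀ : ℕ) : ℤ),
        ctGeneralFun (W.baseChange K) (p ^ M₀) e hμ hadd₁ hadd₂ hgal inv
            (torsionH1ToH1 (W.baseChange K) _ (conjAct W c _ z))
            (torsionH1ToH1 (W.baseChange K) _ (conjAct W c _ t)) =
          ctGeneralFun (W.baseChange K) (p ^ M₀) e hμ hadd₁ hadd₂ hgal inv
            (torsionH1ToH1 (W.baseChange K) _ z) (torsionH1ToH1 (W.baseChange K) _ t)),
      Finite (AddCommGroup.primaryComponent (W.baseChange K).sha p) ∧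
      (∀ c ∈ AddCommGroup.primaryComponent (W.baseChange K).sha p, p ^ M₀ • c = 0) ∧
      Nat.card (AddCommGroup.primaryComponent (W.baseChange K).sha p) ≤ p ^ (2 * M₀) ∧
      padicValNat p (Nat.card (AddCommGroup.primaryComponent (W.baseChange K).sha p)) ≤ 2 * M₀ := by
  intro _ hE hK hD hH P hP hnt hρ M₀ hM₀ _ c hc hcc x₀ hx₀ hmax e hμ hadd₁ hadd₂ hgal halt hnondeg inv
    hPT' hinv hH3 hB hPτ
  exact KolyvaginOrder.card_sha_primary_le_at_of_pointsM_of_reciprocityFinset_of_localDuality W hK hP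
    hnt hp hp2 hρ hM₀ hc hcc hx₀ hmax
    (hpoints_at_of_perLevelChoice hN hK hD hH hP hp hp2 hρ hrec hCM h53 hGZ hγ)
    (@fun _ hM _ hℓ hℓM ↦ KolyvaginReciprocity.kolyvaginReciprocityFinset_of_poitouTate N W K hPT hE
      hK hD hH hP hnt hp hp2 hρ hM hℓ hℓM)
    e hμ hadd₁ hadd₂ hgal halt hnondeg inv hPT' hinv hH3 hB hPτ

/-- **The same on the Kodaira–Néron sub-class AT `p`, from FIVE cite-only inputs**: the binder `hGZ`
([GZ86 III (3.1)] at `p`) SUPPLIED by `KolyvaginHloc.hGZ_of_kodairaNeron` (p319336) under `hKNm`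
(`p ∤ ord_v(Δ_min(E/K))` at every multiplicative `v`) and `hKNa` (`p ≠ 3`, or no additive place of
type IV / IV*).  Binders = those of
`KolyvaginAnnihilator.pow_smul_sha_primary_eq_zero_at_of_leafInputs_of_poitouTate_of_kodairaNeron`
VERBATIM.  CONDITIONAL on EXACTLY {`hPT`, `hrec`, `hCM`, `h53`, `hγ`} AT `p` + `hN` + (KN_p) + the
displayed Cassels–Tate inputs; cite-only; nothing booked; no mark.
[cite: McCallumLMS1991, §1 Theorem (Kolyvagin), Cor. 5.6] [cite: GrossLMS1991, Thm. 2.2 (2), Prop. 6.2 (1)]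
[cite: SilvermanAEC2009, Thm. VII.6.1] -/
theorem card_sha_primary_le_at_of_leafInputs_of_poitouTate_of_kodairaNeron_of_localDuality [NeZero N]
    [W.IsGloballyMinimal] {p : ℕ} (hp : p.Prime) (hp2 : p ≠ 2)
    (hPT : Literature.NumberTheory.GaloisCohomology.poitouTate_sum_localTatePairing_eq_zero K)
    (hN : ∀ [W.IsElliptic], N = W.conductorNorm ℤ)
    (hrec : heegnerPointOfConductor_one_galoisConj N W K)
    (hCM : ∀ [W.IsElliptic] (_hK : IsImaginaryQuadratic K) (_hH : SatisfiesHeegnerHypothesis N K)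
      (Dt : ModularParametrizationData W N) (β : ℤ) (ι : K →+* ℂ),
      (4 * N : ℤ) ∣ β ^ 2 - NumberField.discr K →
      ∀ {M : ℕ}, 1 ≤ M → ∀ (m : ℕ), Squarefree m →
      (∀ q ∈ m.primeFactors, IsKolyvaginPrime N W K p q ∧ FrobEqFrobInfty W K (p ^ M) q) →
      ∃ y : (W.baseChange (ringClassField K ι m)).toAffine.Point,
        WeierstrassCurve.Affine.Point.map (W' := W) (ringClassField K ι m).subtype.toRatAlgHom y =
          heegnerPointComplexOfConductor Dt (NumberField.discr K) β m)
    (h53 : ∀ [W.IsElliptic] (_hK : IsImaginaryQuadratic K) (_hH : SatisfiesHeegnerHypothesis N K)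
      (Dt : ModularParametrizationData W N) (β : ℤ) (ι : K →+* ℂ) {M : ℕ}
      (_hM : 1 ≤ M) {n : ℕ} (_hn : Squarefree n)
      (_hKol : ∀ q ∈ n.primeFactors, IsKolyvaginPrime N W K p q ∧ FrobEqFrobInfty W K (p ^ M) q)
      (d : (m : ℕ) → m ∣ n → KolyvaginHeegnerData Dt β ι m) (m : ℕ) (hm : m ∣ n)
      (τm : ringClassField K ι m ≃ₐ[ℚ] ringClassField K ι m),
      (∀ x : ringClassField K ι m, ((τm x : ringClassField K ι m) : ℂ) = starRingEnd ℂ x) →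
      ∃ σ' ∈ ringClassGal ι m, IsOfFinAddOrder
        (pointGalHom W (ringClassField K ι m) τm (d m hm).y -
          (-W.rootNumber) • pointGalHom W (ringClassField K ι m) σ' (d m hm).y))
    (hKNm : ∀ [W.IsElliptic] (v : HeightOneSpectrum (𝓞 K)),
      (W.baseChange K).HasMultiplicativeReductionAt v →
        ¬ p ∣ (W.baseChange K).ordMinimalDiscriminant v)
    (hKNa : ∀ [W.IsElliptic] (v : HeightOneSpectrum (𝓞 K)),
      (W.baseChange K).HasAdditiveReductionAt v → p ≠ 3 ∨
        ((W.baseChange K).kodairaSymbolAt v ≠ KodairaSymbol.IV ∧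
          (W.baseChange K).kodairaSymbolAt v ≠ KodairaSymbol.IVstar))
    (hγ : ∀ [W.IsElliptic] (_hK : IsImaginaryQuadratic K) (_hH : SatisfiesHeegnerHypothesis N K)
      (Dt : ModularParametrizationData W N) (β : ℤ) (ι : K →+* ℂ) {M : ℕ}
      (_hM : 1 ≤ M) {n : ℕ} (_hn : Squarefree n)
      (_hKol : ∀ q ∈ n.primeFactors, IsKolyvaginPrime N W K p q ∧ FrobEqFrobInfty W K (p ^ M) q)
      (d : (m : ℕ) → m ∣ n → KolyvaginHeegnerData Dt β ι m)
      (m : ℕ) (hm : m ∣ n) (ℓ : ℕ) (hℓ : ℓ ∈ m.primeFactors) [Fact ℓ.Prime]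
      (hΔ : ¬ (ℓ : ℤ) ∣ minimalDiscriminantInt W) (φ₀ : absoluteGaloisGroup (ZMod ℓ)),
      (∀ x : AlgebraicClosure (ZMod ℓ), φ₀ • x = x ^ ℓ) →
      ∀ (hle : ringClassField K ι (m / ℓ) ≤ ringClassField K ι m)
        (γ : ringClassField K ι m ≃ₐ[ℚ] ringClassField K ι m), γ ∈ ringClassGal ι m →
        geomReduction hΔ ((RatClosure.pointsEquiv (K := K) W).symm
            ((d m hm).toGeomPoints (pointGalHom W (ringClassField K ι m) γ (d m hm).y))) =
          φ₀ • geomReduction hΔ ((RatClosure.pointsEquiv (K := K) W).symm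
            ((d m hm).toGeomPoints (pointGalHom W (ringClassField K ι m) γ
              (WeierstrassCurve.Affine.Point.map (W' := W)
                ((RingClassField.inclusion ι hle).restrictScalars ℚ)
                (d (m / ℓ)
                  ((Nat.div_dvd_of_dvd (Nat.dvd_of_mem_primeFactors hℓ)).trans hm)).y))))) :
    ∀ [W.IsElliptic] (_hE : ¬ W.HasCM) (_hK : IsImaginaryQuadratic K)
      (_hD : NumberField.discr K ≠ -3 ∧ NumberField.discr K ≠ -4)
      (_hH : SatisfiesHeegnerHypothesis N K)
      {P : (W.baseChange K).toAffine.Point} (_hP : IsHeegnerPoint N W K P)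
      (_hnt : ¬ IsOfFinAddOrder P) (_hρ : W.HasSurjectiveModNGaloisRep p)
      {M₀ : ℕ} (_hM₀ : 1 ≤ M₀) [NeZero (p ^ M₀)] {c : K ≃ₐ[ℚ] K} (_hc : c ≠ 1) (_hcc : c * c = 1)
      {x₀ : (W.baseChange K).toAffine.Point} (_hx₀ : p ^ M₀ • x₀ = P)
      (_hmax : ∀ Q : (W.baseChange K).toAffine.Point, p ^ (M₀ + 1) • Q ≠ P)
      (e : geomTorsion (W.baseChange K) ((p ^ M₀ * p ^ M₀ : ℕ) : ℤ) →
        geomTorsion (W.baseChange K) ((p ^ M₀ * p ^ M₀ : ℕ) : ℤ) → AlgebraicClosure K)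
      (hμ : ∀ S T, e S T ^ (p ^ M₀ * p ^ M₀) = 1)
      (hadd₁ : ∀ S₁ S₂ T, e (S₁ + S₂) T = e S₁ T * e S₂ T)
      (hadd₂ : ∀ S T₁ T₂, e S (T₁ + T₂) = e S T₁ * e S T₂)
      (hgal : ∀ (σ : absoluteGaloisGroup K) (S T : geomTorsion (W.baseChange K) ((p ^ M₀ * p ^ M₀ : ℕ) : ℤ)),
        σ • e S T = e (σ • S) (σ • T))
      (halt : ∀ T, e T T = 1) (hnondeg : ∀ T, (∀ S, e S T = 1) → T = 0)
      (inv : LocalInvariants K (p ^ M₀ * p ^ M₀)) (hPT' : inv.SumInvLocalizationEqZero)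
      (hinv : ∀ v : HeightOneSpectrum (𝓞 K), Injective (inv (Sum.inr v)))
      (hH3 : ∀ x : galoisCohomology (mu K (p ^ M₀ * p ^ M₀)) 3,
        (∀ v : Place K, galoisCohomology.localization (mu K (p ^ M₀ * p ^ M₀)) v 3 x = 0) → x = 0)
      (hB : Literature.GroupTheory.FiniteAbelian.IsLevelPairing (p ^ M₀)
        (ctLevelPairing (W.baseChange K) (p ^ M₀) e hμ hadd₁ hadd₂ hgal inv halt hPT' hH3
          (localTerm_finite_support (W := W.baseChange K) (m := p ^ M₀) (e := e) (hμ := hμ)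
            (hadd₁ := hadd₁) (hadd₂ := hadd₂) (hgal := hgal) halt inv)))
      (hPτ : ∀ z ∈ selmerGroup (W.baseChange K) ((p ^ M₀ * p ^ M₀ : ℕ) : ℤ),
        ∀ t ∈ selmerGroup (W.baseChange K) ((p ^ M₀ * p ^ M₀ : ℕ) : ℤ),
        ctGeneralFun (W.baseChange K) (p ^ M₀) e hμ hadd₁ hadd₂ hgal inv
            (torsionH1ToH1 (W.baseChange K) _ (conjAct W c _ z))
            (torsionH1ToH1 (W.baseChange K) _ (conjAct W c _ t)) =
          ctGeneralFun (W.baseChange K) (p ^ M₀) e hμ hadd₁ hadd₂ hgal inv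
            (torsionH1ToH1 (W.baseChange K) _ z) (torsionH1ToH1 (W.baseChange K) _ t)),
      Finite (AddCommGroup.primaryComponent (W.baseChange K).sha p) ∧
      (∀ c ∈ AddCommGroup.primaryComponent (W.baseChange K).sha p, p ^ M₀ • c = 0) ∧
      Nat.card (AddCommGroup.primaryComponent (W.baseChange K).sha p) ≤ p ^ (2 * M₀) ∧
      padicValNat p (Nat.card (AddCommGroup.primaryComponent (W.baseChange K).sha p)) ≤ 2 * M₀ :=
  card_sha_primary_le_at_of_leafInputs_of_poitouTate_of_localDuality hp hp2 hPT hN hrec hCM h53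
    (@fun _ hK _ Dt _ ι _ _ _ hn hKol d ↦
      KolyvaginHloc.hGZ_of_kodairaNeron hK ι Dt hp hp2 hn hKol d hKNm hKNa) hγ

end Summit.BirchSwinnertonDyer.Rank1Residual.X11b.KolyvaginOrder

end
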